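import Summits.NavierStokesRegularity.FunctionalMining.C1WeightIntegral
import HarnessLib

/-!
# FunctionalMining — differentiation under `∫_{T^d}` with a `C¹` outer function, vector-valued fields

Search for candidate a priori estimates; no regularity claim. Cell `pub-nsfunc`, prove seat
(gen 11). The vector-valued twin of `C1Weight.hasDerivWithinAt_integral_comp_of_contDiffOn_one`
(`C1WeightIntegral`): for `θ` jointly smooth on `[a, b] × T^d` with values in a proper real normed
space `G` (e.g. `ℝ^d`, `ℝ^{d×d}`) and `Φ : G → ℝ` of class `C¹` on an open set containing the values
of `θ`, `d/dt ∫ Φ(θ) = ∫ DΦ(θ)[∂ₜθ]` (one-sided within `[a, b]`). Needed by the K0 rows with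
non-smooth power weights of VECTOR/TENSOR densities at real exponents `1 < q < 2`
(`∫‖∇π‖^q`, `∫|Π^dev|^q`: the weight `w ↦ ‖w‖^q` is `C¹` on `ℝ^n` for `q > 1`, Mathlib
`contDiff_norm_rpow`, while `r ↦ r^{q/2}` is not `C¹` at `r = 0`). Same proof: pointwise chain rule,
tube lemma, dominated convergence (`Torus.hasDerivWithinAt_integral_of_convex`).

## Main statement

* `C1Weight.hasDerivWithinAt_integral_comp_fderiv`.
-/

noncomputable section

open MeasureTheory Set Filter Topology

namespace Summit.NavierStokesRegularity.FunctionalMining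

open Literature.Analysis.FunctionSpaces

namespace C1Weight

variable {d : Type*} [Fintype d]
variable {G : Type*} [NormedAddCommGroup G] [NormedSpace ℝ G]

/-- **Differentiation under `∫_{T^d}` with a `C¹` outer function (vector-valued field).** For `θ`
jointly smooth on `[a, b] × T^d` (`a < b`) with values in a proper real normed space `G` and `Φ` of
class `C¹` on an open `U ⊇ θ([a, b] × T^d)`, `s ↦ ∫ Φ(θ(s, x)) dx` has the one-sided derivative
`∫ DΦ(θ(t, x))[∂ₜθ(t, x)] dx` within `[a, b]` at every `t ∈ [a, b]` (pointwise chain rule; the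
derivatives are uniformly bounded for `s` near `t` by the tube lemma — the values `θ(s, ·)` stay in a
compact thickening of `θ(t, T^d)` inside `U`, where `DΦ` is bounded — and dominated convergence,
tree `Torus.hasDerivWithinAt_integral_of_convex`). [folklore] -/
theorem hasDerivWithinAt_integral_comp_fderiv [ProperSpace G] {a b : ℝ} (hab : a < b)
    {θ : ℝ → UnitAddTorus d → G} (hθ : Torus.IsSmoothSpaceTimeOn (Icc a b) θ)
    {Φ : G → ℝ} {U : Set G} (hUo : IsOpen U) (hΦ : ContDiffOn ℝ 1 Φ U)
    (hmaps : ∀ s ∈ Icc a b, ∀ x, θ s x ∈ U) {t : ℝ} (ht : t ∈ Icc a b) :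
    HasDerivWithinAt (fun s => ∫ x, Φ (θ s x))
      (∫ x, fderiv ℝ Φ (θ t x) (Torus.timeDerivWithin (Icc a b) θ t x)) (Icc a b) t := by
  set S : Set ℝ := Icc a b with hSdef
  have hU : UniqueDiffOn ℝ S := uniqueDiffOn_Icc hab
  have hθc : ∀ s ∈ S, Continuous (θ s) := fun s hs => (hθ.isSmooth_slice hs).continuous
  have hΦc : ContinuousOn Φ U := hΦ.continuousOn
  have hΦ'c : ContinuousOn (fderiv ℝ Φ) U := hΦ.continuousOn_fderiv_of_isOpen hUo le_rfl
  have hΦd : ∀ y ∈ U, HasFDerivAt Φ (fderiv ℝ Φ y) y := fun y hy =>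
    ((hΦ.differentiableOn (by simp)).differentiableAt (hUo.mem_nhds hy)).hasFDerivAt
  -- a compact thickening of the values at time `t` inside `U`, and a bound for `DΦ` there
  set K : Set G := range (θ t) with hKdef
  have hKc : IsCompact K := isCompact_range (hθc t ht)
  have hKU : K ⊆ U := by
    rintro _ ⟨x, rfl⟩
    exact hmaps t ht x
  obtain ⟨ρ, hρ, hρU⟩ := hKc.exists_cthickening_subset_open hUo hKU
  have hK₁c : IsCompact (Metric.cthickening ρ K) := hKc.cthickening
  obtain ⟨B, hB⟩ : ∃ B : ℝ, ∀ y ∈ Metric.cthickening ρ K, ‖fderiv ℝ Φ y‖ ≤ B :=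
    hK₁c.exists_bound_of_continuousOn (hΦ'c.mono hρU)
  have hB0 : 0 ≤ B :=
    (norm_nonneg _).trans (hB (θ t 0) (Metric.self_subset_cthickening K ⟨0, rfl⟩))
  -- a bound for the time derivative at time `t`
  have hDc : Continuous (Torus.timeDerivWithin S θ t) :=
    (hθ.isSmooth_timeDerivWithin hU ht).continuous
  obtain ⟨M, hM⟩ : ∃ M : ℝ, ∀ x, ‖Torus.timeDerivWithin S θ t x‖ ≤ M := by
    obtain ⟨M, hM⟩ := isCompact_univ.exists_bound_of_continuousOn hDc.continuousOn
    exact ⟨M, fun x => hM x (mem_univ x)⟩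
  have hM0 : 0 ≤ M + 1 := by
    have := (norm_nonneg _).trans (hM 0)
    linarith
  -- the uniform bound on `DΦ(θ(s, x))[∂ₜθ(s, x)]` for `s` near `t`
  have hbound : ∀ᶠ s in 𝓝[S] t, ∀ x,
      ‖fderiv ℝ Φ (θ s x) (Torus.timeDerivWithin S θ s x)‖ ≤ B * (M + 1) := by
    filter_upwards [hθ.eventually_norm_sub_lt ht hρ,
      hθ.eventually_norm_timeDerivWithin_sub_lt hU ht one_pos] with s hs1 hs2 x
    have hy : θ s x ∈ Metric.cthickening ρ K := by
      refine Metric.mem_cthickening_of_dist_le (θ s x) (θ t x) ρ K ⟨x, rfl⟩ ?_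
      rw [dist_eq_norm]
      exact (hs1 x).le
    have h2 : ‖Torus.timeDerivWithin S θ s x‖ ≤ M + 1 :=
      calc ‖Torus.timeDerivWithin S θ s x‖
          ≤ ‖Torus.timeDerivWithin S θ t x‖ +
              ‖Torus.timeDerivWithin S θ s x - Torus.timeDerivWithin S θ t x‖ :=
            norm_le_norm_add_norm_sub' _ _
        _ ≤ M + 1 := add_le_add (hM x) (hs2 x).le
    calc ‖fderiv ℝ Φ (θ s x) (Torus.timeDerivWithin S θ s x)‖
        ≤ ‖fderiv ℝ Φ (θ s x)‖ * ‖Torus.timeDerivWithin S θ s x‖ :=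
          ContinuousLinearMap.le_opNorm _ _
      _ ≤ B * (M + 1) := mul_le_mul (hB _ hy) h2 (norm_nonneg _) hB0
  refine Torus.hasDerivWithinAt_integral_of_convex (μ := volume) (convex_Icc a b) ht
    (F := fun s x => Φ (θ s x))
    (F' := fun s x => fderiv ℝ Φ (θ s x) (Torus.timeDerivWithin S θ s x)) ?_ ?_ hbound ?_
  · intro s hs
    exact (hΦc.comp_continuous (hθc s hs) (hmaps s hs)).integrable_unitAddTorus
  · intro s hs x
    exact (hΦd _ (hmaps s hs x)).comp_hasDerivWithinAt s (hθ.hasDerivWithinAt_slice hs x)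
  · exact ((hΦ'c.comp_continuous (hθc t ht) (hmaps t ht)).clm_apply hDc).aestronglyMeasurable

/-- The whole-space case: `Φ` of class `C¹` on all of `G` (e.g. `w ↦ ‖w‖^q`, `q > 1`). [folklore] -/
theorem hasDerivWithinAt_integral_comp_fderiv_of_contDiff [ProperSpace G] {a b : ℝ} (hab : a < b)
    {θ : ℝ → UnitAddTorus d → G} (hθ : Torus.IsSmoothSpaceTimeOn (Icc a b) θ)
    {Φ : G → ℝ} (hΦ : ContDiff ℝ 1 Φ) {t : ℝ} (ht : t ∈ Icc a b) :
    HasDerivWithinAt (fun s => ∫ x, Φ (θ s x))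
      (∫ x, fderiv ℝ Φ (θ t x) (Torus.timeDerivWithin (Icc a b) θ t x)) (Icc a b) t :=
  hasDerivWithinAt_integral_comp_fderiv hab hθ isOpen_univ hΦ.contDiffOn (fun _ _ _ => mem_univ _) ht

end C1Weight

end Summit.NavierStokesRegularity.FunctionalMining
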